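import Literature.NumberTheory.ComplexMultiplication.CMTypeRankTwoBlocks
import Mathlib.LinearAlgebra.Basis.VectorSpace
import HarnessLib

/-!
# Two-block CM types: the splitting principle CHARACTERISES rank additivity

Sequel of `NumberTheory/ComplexMultiplication/CMTypeRankTwoBlocks`.  There: if `rank(Σ₁ ⊔ Σ₂) + 1 = rank Σ₁ + rank Σ₂`
then every weight `f` on `E₁ ⊔ E₂` balanced for the glued type has balanced blocks `f ∘ inl`, `f ∘ inr`
(`isBalanced_inl/inr_of_typeRank_sum_eq`).  Here the CONVERSE: if rank additivity fails — `rank(Σ₁ ⊔ Σ₂) + 1 <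
rank Σ₁ + rank Σ₂`, i.e. `Hg(X × Y) ⊊ Hg(X) × Hg(Y)` — then some rational weight balanced for `Σ₁ ⊔ Σ₂` has an
UNBALANCED block (`exists_isBalanced_sum_not_isBalanced_of_typeRank_lt`); so

  `rank(Σ₁ ⊔ Σ₂) + 1 = rank Σ₁ + rank Σ₂  ⟺  every glued-balanced weight splits into balanced blocks`

(`typeRank_sum_add_one_eq_iff_forall_isBalanced`).  This is the weight-space form of Moonen–Zarhin's equivalence (3.1)
("`Hg(X₁ × X₂) = Hg(X₁) × Hg(X₂)` iff all Hodge classes on all `X₁^k × X₂^l` are generated by those of the factors"):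
a balanced RATIONAL weight with multiplicities is a Hodge class on suitable powers.  PROOF: the span `W` of the pairs
`(u¹_g, u²_g)` is a PROPER subspace of `U(Σ₁) × U(Σ₂)`; a linear functional `φ` on `ℚ^{E₁} × ℚ^{E₂}` killing `W` but
not some `(p₁, p₂) ∈ U(Σ₁) × U(Σ₂)` (`Submodule.exists_le_ker_of_notMem`) is `(a, b) ↦ ⟨f₁, a⟩ + ⟨f₂, b⟩` for the weight
`f = (f₁, f₂)`, which is glued-balanced (`φ(W) = 0`) while `⟨f₁, p₁⟩ ≠ 0` or `⟨f₂, p₂⟩ ≠ 0` forbids the corresponding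
block to be orthogonal to `U(Σ_i)`.  No definition, no named fact.  NOT here: the translation of an unbalanced block
into an exceptional Hodge class on a power `X^k × Y^l` (Pohlmann's theorem, other direction).

## References
* [MoonenZarhin1999LowDim] B. Moonen, Yu. Zarhin, Math. Ann. 315 (1999) 711–733, §3 (3.1).
* [Gordon1999HodgeAVSurvey] B. B. Gordon, *A survey of the Hodge conjecture for abelian varieties*, 7.5–7.7, §9.2.
-/

set_option autoImplicit false

noncomputable section

open scoped BigOperators

namespace Literature.NumberTheory.ComplexMultiplication

variable {G : Type*} [Group G] {E₁ E₂ : Type*} [MulAction G E₁] [MulAction G E₂] [Fintype E₁] [Fintype E₂]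
  {Φ₁ : Set E₁} {Φ₂ : Set E₂} {ρ : G}

/-- `dim (p × q) = dim p + dim q` for submodules of the two weight spaces. [folklore] -/
private theorem finrank_prod_eq'' (p : Submodule ℚ (E₁ → ℚ)) (q : Submodule ℚ (E₂ → ℚ)) :
    Module.finrank ℚ (p.prod q) = Module.finrank ℚ p + Module.finrank ℚ q := by
  have hinj : Function.Injective (p.subtype.prodMap q.subtype) := by
    rintro ⟨a, b⟩ ⟨a', b'⟩ h
    simp only [LinearMap.prodMap_apply, Submodule.subtype_apply, Prod.mk.injEq] at h
    exact Prod.ext (Subtype.ext h.1) (Subtype.ext h.2)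
  have hrange : LinearMap.range (p.subtype.prodMap q.subtype) = p.prod q := by
    rw [LinearMap.range_prodMap, Submodule.range_subtype, Submodule.range_subtype]
  rw [← hrange, LinearMap.finrank_range_of_inj hinj, Module.finrank_prod]

/-- A vector orthogonal to a set of vectors is orthogonal to their span. [folklore] -/
private theorem dotProduct_eq_zero_of_mem_span' {E : Type*} [Fintype E] {S : Set (E → ℚ)} {b w : E → ℚ}
    (hb : ∀ s ∈ S, dotProduct b s = 0) (hw : w ∈ Submodule.span ℚ S) : dotProduct b w = 0 := by
  induction hw using Submodule.span_induction with
  | mem s hs => exact hb s hs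
  | zero => exact dotProduct_zero b
  | add u v _ _ hu hv => rw [dotProduct_add, hu, hv, add_zero]
  | smul c u _ hu => rw [dotProduct_smul, hu, smul_zero]

/-- A linear functional on `ℚ^{E₁} × ℚ^{E₂}` is `(a, b) ↦ ⟨f₁, a⟩ + ⟨f₂, b⟩` for the weights `f₁ x = φ(e_x, 0)`,
`f₂ y = φ(0, e_y)`. [folklore] -/
private theorem linearMap_apply_eq_dotProduct [DecidableEq E₁] [DecidableEq E₂]
    (φ : ((E₁ → ℚ) × (E₂ → ℚ)) →ₗ[ℚ] ℚ) (v : (E₁ → ℚ) × (E₂ → ℚ)) :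
    φ v = dotProduct (fun x => φ (Pi.single x 1, 0)) v.1 + dotProduct (fun y => φ (0, Pi.single y 1)) v.2 := by
  have hv : v = (∑ x, v.1 x • ((Pi.single x (1 : ℚ), (0 : E₂ → ℚ)) : (E₁ → ℚ) × (E₂ → ℚ))) +
      ∑ y, v.2 y • (((0 : E₁ → ℚ), Pi.single y (1 : ℚ)) : (E₁ → ℚ) × (E₂ → ℚ)) := by
    refine Prod.ext ?_ ?_
    · rw [Prod.fst_add, Prod.fst_sum, Prod.fst_sum]
      simp only [Prod.smul_mk, smul_zero, Finset.sum_const_zero, add_zero]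
      funext x
      rw [Finset.sum_apply, Finset.sum_eq_single x (fun x' _ hx' => by
        rw [Pi.smul_apply, Pi.single_eq_of_ne (Ne.symm hx'), smul_zero]) (fun h => (h (Finset.mem_univ x)).elim),
        Pi.smul_apply, Pi.single_eq_same, smul_eq_mul, mul_one]
    · rw [Prod.snd_add, Prod.snd_sum, Prod.snd_sum]
      simp only [Prod.smul_mk, smul_zero, Finset.sum_const_zero, zero_add]
      funext y
      rw [Finset.sum_apply, Finset.sum_eq_single y (fun y' _ hy' => by
        rw [Pi.smul_apply, Pi.single_eq_of_ne (Ne.symm hy'), smul_zero]) (fun h => (h (Finset.mem_univ y)).elim),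
        Pi.smul_apply, Pi.single_eq_same, smul_eq_mul, mul_one]
  conv_lhs => rw [hv]
  rw [map_add, map_sum, map_sum]
  simp only [map_smul, smul_eq_mul, dotProduct, mul_comm (v.1 _), mul_comm (v.2 _)]

/-- **Failure of rank additivity produces a glued-balanced weight with an unbalanced block.**  If
`rank(Σ₁ ⊔ Σ₂) + 1 < rank Σ₁ + rank Σ₂` (`Hg(X × Y) ⊊ Hg(X) × Hg(Y)`), there is a rational weight `f` on `E₁ ⊔ E₂`
satisfying Pohlmann's condition for `Σ₁ ⊔ Σ₂` whose blocks `f ∘ inl`, `f ∘ inr` are NOT both balanced.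
[cite: MoonenZarhin1999LowDim, §3 (3.1)] [cite: Gordon1999HodgeAVSurvey, 7.5 (1) ⟹ (3)] -/
theorem exists_isBalanced_sum_not_isBalanced_of_typeRank_lt [Nonempty E₁] [Nonempty E₂] (h₁ : IsCMTypeWith ρ Φ₁)
    (h₂ : IsCMTypeWith ρ Φ₂)
    (hlt : typeRank G {z : E₁ ⊕ E₂ | Sum.elim (· ∈ Φ₁) (· ∈ Φ₂) z} + 1 < typeRank G Φ₁ + typeRank G Φ₂) :
    ∃ f : E₁ ⊕ E₂ → ℚ, IsBalanced G {z : E₁ ⊕ E₂ | Sum.elim (· ∈ Φ₁) (· ∈ Φ₂) z} f ∧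
      ¬ (IsBalanced G Φ₁ (f ∘ Sum.inl) ∧ IsBalanced G Φ₂ (f ∘ Sum.inr)) := by
  classical
  -- the span of the pairs is a proper subspace of `U(Σ₁) × U(Σ₂)`
  set W := Submodule.span ℚ (Set.range fun g : G => (antiVec Φ₁ g, antiVec Φ₂ g)) with hW
  have hWlt : ¬ ((antiSpan G Φ₁).prod (antiSpan G Φ₂) ≤ W) := by
    intro hle
    have h := Submodule.finrank_mono hle
    rw [finrank_prod_eq'', hW, ← map_antiSpan_sum_eq_span, LinearEquiv.finrank_map_eq] at h
    rw [(h₁.sum h₂).typeRank_eq_finrank_antiSpan_add_one, h₁.typeRank_eq_finrank_antiSpan_add_one,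
      h₂.typeRank_eq_finrank_antiSpan_add_one] at hlt
    omega
  obtain ⟨v, hvP, hvW⟩ := SetLike.not_le_iff_exists.1 hWlt
  -- a functional killing `W` but not `v`
  obtain ⟨φ, hφv, hWφ⟩ := Submodule.exists_le_ker_of_notMem hvW
  set f₁ : E₁ → ℚ := fun x => φ (Pi.single x 1, 0) with hf₁
  set f₂ : E₂ → ℚ := fun y => φ (0, Pi.single y 1) with hf₂
  have hφ : ∀ w : (E₁ → ℚ) × (E₂ → ℚ), φ w = dotProduct f₁ w.1 + dotProduct f₂ w.2 :=
    linearMap_apply_eq_dotProduct φ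
  refine ⟨Sum.elim f₁ f₂, ?_, fun hbal => ?_⟩
  · -- glued-balanced: `φ` kills every pair `(u¹_g, u²_g)`
    rw [isBalanced_iff_forall_dotProduct_antiVec]
    intro g
    rw [dotProduct_antiVec_sum, Sum.elim_comp_inl, Sum.elim_comp_inr, ← hφ (antiVec Φ₁ g, antiVec Φ₂ g)]
    exact LinearMap.mem_ker.1 (hWφ (Submodule.subset_span ⟨g, rfl⟩))
  · -- but `φ v ≠ 0`: one block pairs non-trivially with `U(Σ_i)`
    obtain ⟨hb₁, hb₂⟩ := hbal
    rw [Sum.elim_comp_inl, isBalanced_iff_forall_dotProduct_antiVec] at hb₁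
    rw [Sum.elim_comp_inr, isBalanced_iff_forall_dotProduct_antiVec] at hb₂
    apply hφv
    rw [hφ v, dotProduct_eq_zero_of_mem_span' (S := Set.range fun g : G => antiVec Φ₁ g)
        (by rintro _ ⟨g, rfl⟩; exact hb₁ g) hvP.1,
      dotProduct_eq_zero_of_mem_span' (S := Set.range fun g : G => antiVec Φ₂ g)
        (by rintro _ ⟨g, rfl⟩; exact hb₂ g) hvP.2, add_zero]

/-- **Rank additivity ⟺ the splitting principle.**  For CM types `Σ₁`, `Σ₂` on two `G`-sets:
`rank(Σ₁ ⊔ Σ₂) + 1 = rank Σ₁ + rank Σ₂` iff every rational weight on `E₁ ⊔ E₂` balanced for the glued type has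
balanced blocks — the weight-space form of Moonen–Zarhin's (3.1) "`Hg(X₁ × X₂) = Hg(X₁) × Hg(X₂)` iff all Hodge
classes on all `X₁^k × X₂^l` come from the factors". [cite: MoonenZarhin1999LowDim, §3 (3.1)] -/
theorem typeRank_sum_add_one_eq_iff_forall_isBalanced [Nonempty E₁] [Nonempty E₂] (h₁ : IsCMTypeWith ρ Φ₁)
    (h₂ : IsCMTypeWith ρ Φ₂) :
    typeRank G {z : E₁ ⊕ E₂ | Sum.elim (· ∈ Φ₁) (· ∈ Φ₂) z} + 1 = typeRank G Φ₁ + typeRank G Φ₂ ↔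
      ∀ f : E₁ ⊕ E₂ → ℚ, IsBalanced G {z : E₁ ⊕ E₂ | Sum.elim (· ∈ Φ₁) (· ∈ Φ₂) z} f →
        IsBalanced G Φ₁ (f ∘ Sum.inl) ∧ IsBalanced G Φ₂ (f ∘ Sum.inr) := by
  constructor
  · intro hrank f hf
    exact ⟨isBalanced_inl_of_typeRank_sum_eq h₁ h₂ hrank hf, isBalanced_inr_of_typeRank_sum_eq h₁ h₂ hrank hf⟩
  · intro hsplit
    by_contra hne
    have hlt : typeRank G {z : E₁ ⊕ E₂ | Sum.elim (· ∈ Φ₁) (· ∈ Φ₂) z} + 1 < typeRank G Φ₁ + typeRank G Φ₂ :=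
      lt_of_le_of_ne (typeRank_sum_add_one_le h₁ h₂) hne
    obtain ⟨f, hf, hnot⟩ := exists_isBalanced_sum_not_isBalanced_of_typeRank_lt h₁ h₂ hlt
    exact hnot (hsplit f hf)

end Literature.NumberTheory.ComplexMultiplication

end
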